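import Mathlib
import HarnessLib
import HarnessLib.Audit
import Summits.Langlands.Langlands.Theorems.DyadicDoorSplit
import Literature.NumberTheory.Automorphic.AbelianTotallyRealModularity
import Literature.NumberTheory.Automorphic.ThorneQInfinityModular
import Literature.NumberTheory.NumberFields.CubicFieldThreeRealPlaces
import Literature.NumberTheory.NumberFields.ConjugationSolvable

/-!
# TwoDivisionFieldSplit (PRELUDE: §1–§3 — dial, bridge lemmas, pieces) — lens-5 g29 node on RES = `DyadicDoorSplit.DyadicDegenerateResidual`

TARGET (tree decl, BY NAME): RES = `Summit.Langlands.Langlands.Theorems.DyadicDoorSplit.DyadicDegenerateResidual`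
(g28, `Theorems/DyadicDoorSplitPrelude.lean`): every integral `E` (`Δ ≠ 0`) over an UNANCHORED totally real field
`K₀` of degree `≥ 6` (`DepthIsolationSplit.UnanchoredBox K₀`), of residual moduli degree
(`JDegreeFilterSplit.InResidualRange K₀ E`), OFF the Allen locus, is modular.  RES is the declared residual of the
lineage REST (stmt-Langlands-26998) → REST_E (g26) → LJR (g27) → ADS ∧ RES (g28); g28 typed RES as the conjunction
of four sub-loci R_tors ∧ R_sq ∧ R_ss ∧ R_cm (`residual_iff_subloci`), all IDEA-NEEDED.

THESIS (lens «finite range + generic regime + bridge», one level below g28).  DIAL = the `2`-DIVISION FIELD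
`L = K₀(E[2])`, the splitting field of the `2`-division cubic, read through the ARCHIMEDEAN SIGN of `Δ`
(`disc(cubic) = 16 Δ`): FINITE RANGE = `Gal(L/K₀) ≤ S₃` (index `1, 2, 3, 6`) × (sign pattern of `Δ` at the real
places); GENERIC REGIME = index `6` with Allen's dyadic conditions = g28's ADS (print modulo ADC, unchanged);
BRIDGE (PROVED here, `modular_of_discTotallyPositive`): if `Δ` is TOTALLY POSITIVE then `L` is a totally real
(three real roots at every place: `Literature…conj_eq_of_mem_roots_of_discr_pos`), Galois, SOLVABLE (`≤ S₃`)
extension of `K₀`, `E ⊗ L` has FULL `2`-torsion, the same moduli degree and `Δ ≠ 0`, `[L:ℚ] ≥ 6`, and `L` is either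
again a box field or ANCHORED; so `E ⊗ L` is modular by F2T (box) or F2T_anch (anchored), and `E` is modular by
solvable descent DESC (g27's print junction `JDegreeFilterSplit.SolvableDescentModularity`, Langlands 1980 /
Thorne 2016 Lemma 7.1).  Hence the whole TOTALLY-POSITIVE part of RES — all of R_sq (a square is totally positive),
and the `Δ ≫ 0` halves of R_tors and R_ss — collapses onto ONE core statement F2T = «full-`2`-torsion curves of
residual moduli degree over box fields are modular» (`ρ̄_{E,2}` TRIVIAL: the bottom of the dial), and the residual
shrinks to the curves with `Δ < 0` at some real place:

  RES ⟺ F2T ∧ R₂⁻ ∧ R_ss⁻ ∧ R_cm⁶   (junctions DESC, F2T_anch; `residual_iff_pieces`; necessity unconditional).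

PIECES (decls of this file; tags for the cell):
* F2T  `FullTwoTorsionResidual` — NEW RESIDUAL CORE · WEAKER (⟸ R_tors AND ⟸ R_sq, both proved here) · IDEA-NEEDED
  (no print over a general totally real field: Kraus 2019 Thms 2–3 ASSUME it; Anni–Siksek 2016 Thm 2 needs `K` real
  abelian; Thorne 2026 Thm B is potential; Kisin `2`-adic / [KW2] need non-solvable residual image).
* R₂⁻  `MixedSignTwoTorsionResidual` — residual · WEAKER (⟸ R_tors) · IDEA-NEEDED: a rational `2`-torsion point and
  `Δ < 0` at some real place.
* R_ss⁻ `NegativePlaceSupersingularResidual` — residual · WEAKER (⟸ R_ss) · IDEA-NEEDED: no rational `2`-torsion,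
  `v(j) > 0` at some `v ∣ 2`, `Δ < 0` somewhere.
* R_cm⁶ `IrreducibleCMComponentResidual` — residual · WEAKER (⟸ R_cm) · IDEA-NEEDED / BARRIER-candidate: no rational
  `2`-torsion, `Δ` totally negative and a dyadic square everywhere (Allen's CM-component corner, index `6`).
* F2T_anch `AnchoredFullTwoTorsion` — GLUE · S-IMPLIED, NOT RES-implied (the declared PRICE of the overfield move):
  full-`2`-torsion curves of residual moduli degree over ANCHORED fields of degree `≥ 6`; its (A)-cell is discharged
  from the tree facts `Yoshikawa2019_theorem1_2` / `Thorne2019_thm1` BY NAME (`anchoredFullTwoTorsion_of_cells`),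
  leaving F2T_B `AnchoredBFullTwoTorsion` (the `15`/`21`-stable solvable-cover cells = E-level cores of host items
  stmt-Langlands-26996/26997 on the full-`2`-torsion locus; PRINT BRIDGE by proof: Thorne 2016 Thm 7.6, Yoshikawa).
* DESC (tree, g27) and ADC/ADS (tree, g28) — PRINT junctions, unchanged.

KERNEL: `modular_of_discTotallyPositive` (the bridge), `residual_iff_pieces` (exactness), the WEAKER certificates
`fullTwoTorsionResidual_of_rationalTwoTorsion` / `_of_squareDisc` / …, and the compositions BY NAME
`largeJResidual_of_leaves` / `largeJResidual_of_cells` (→ LJR via g28's `largeJResidual_of_sectors`),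
`restE_of_leaves` (→ REST_E via `JDegreeFilterSplit.restE_of_jLeaves`), `closes_target` / `closes_byName` (→ REST
stmt-Langlands-26998 via `JDegreeFilterSplit.closes_target`).  0 sorry; axioms of `closes_target`:
[propext, Classical.choice, Quot.sound].  No `instance`, no `notation`; helper names never bare `closes`.
-/

set_option linter.dupNamespace false
set_option linter.unusedVariables false

open scoped NumberField IntermediateField ComplexConjugate
open NumberField IsDedekindDomain Literature.NumberTheory.Automorphic
open Summit.Langlands.Langlands.Theorems.DepthIsolationSplit (UnanchoredBox UnanchoredHighDegreeModularE
  IntegralModelTransferPointwise SatakeAvatarTwo satakeAvatarTwo_of_host)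
open Summit.Langlands.Langlands.Theorems.JDegreeFilterSplit (jInv jDeg InResidualRange LargeJResidual
  RatBaseChangeModularity SmallFieldBaseChange SolvableDescentModularity jInv_baseChange jDeg_baseChange
  baseChange_Δ_ne_zero restE_of_jLeaves largeJResidual_of_restE)
open Summit.Langlands.Langlands.Theorems.DyadicDoorSplit (disc JNonposAtTwo NoRationalTwoTorsion DiscNonsquare
  AllenConditionC AllenLocus AllenDyadicCorollary AllenDoorSector DyadicDegenerateResidual
  RationalTwoTorsionResidual SquareDiscResidual SupersingularAtTwoResidual CMComponentResidual
  not_allenLocus_iff residual_iff_subloci largeJResidual_of_sectors allenDoorSector_of_corollary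
  not_isSquare_of_realEmbedding_neg twoTorsionPolynomial_map baseChange_baseChange_eq_map disc_baseChange)

namespace Summit.Langlands.Langlands.Theorems.TwoDivisionFieldSplit

/-! ## §1 The dial: the archimedean sign of `Δ` and the splitting of the `2`-division cubic -/

/-- `Δ(E)` is TOTALLY POSITIVE: positive at every real place of `K₀`.  Equivalently (disc of the `2`-division
cubic `= 16 Δ`) the `2`-division field `K₀(E[2])` is totally real. -/
def DiscTotallyPositive (K₀ : Type) [Field K₀] [NumberField K₀] (E : WeierstrassCurve (𝓞 K₀)) : Prop :=
  ∀ σ : K₀ →+* ℝ, 0 < σ (disc K₀ E)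

/-- FULL RATIONAL `2`-TORSION: the `2`-division cubic `4x³ + b₂x² + 2b₄x + b₆` of the generic fibre splits into
linear factors over `K₀`, i.e. `E[2] ⊂ E(K₀)` (`ρ̄_{E,2}` trivial). -/
def FullTwoTorsion (K₀ : Type) [Field K₀] [NumberField K₀] (E : WeierstrassCurve (𝓞 K₀)) : Prop :=
  ((E.baseChange K₀).twoTorsionPolynomial).toPoly.Splits

/-- The discriminant read in `K₀` is nonzero. -/
theorem disc_ne_zero (K₀ : Type) [Field K₀] [NumberField K₀] (E : WeierstrassCurve (𝓞 K₀)) (hΔ : E.Δ ≠ 0) :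
    disc K₀ E ≠ 0 := fun h =>
  hΔ ((FaithfulSMul.algebraMap_injective (𝓞 K₀) K₀) (by rw [map_zero]; exact h))

/-- The leading coefficient of the `2`-division cubic is `4 ≠ 0`. -/
theorem twoTorsionPolynomial_a_ne_zero (K₀ : Type) [Field K₀] [NumberField K₀]
    (E : WeierstrassCurve (𝓞 K₀)) : ((E.baseChange K₀).twoTorsionPolynomial).a ≠ 0 := by
  show (4 : K₀) ≠ 0
  norm_num

/-- The discriminant of the `2`-division cubic is `16 Δ`. -/
theorem twoTorsionPolynomial_discr_eq (K₀ : Type) [Field K₀] [NumberField K₀]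
    (E : WeierstrassCurve (𝓞 K₀)) : ((E.baseChange K₀).twoTorsionPolynomial).discr = 16 * disc K₀ E := by
  rw [WeierstrassCurve.twoTorsionPolynomial_discr, WeierstrassCurve.baseChange, WeierstrassCurve.map_Δ]
  rfl

/-- A square nonzero discriminant is totally positive. -/
theorem discTotallyPositive_of_isSquare (K₀ : Type) [Field K₀] [NumberField K₀]
    (E : WeierstrassCurve (𝓞 K₀)) (hΔ : E.Δ ≠ 0) (hsq : IsSquare (disc K₀ E)) :
    DiscTotallyPositive K₀ E := by
  intro σ
  obtain ⟨a, ha⟩ := hsq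
  have ha0 : a ≠ 0 := by
    rintro rfl
    exact disc_ne_zero K₀ E hΔ (by rw [ha, mul_zero])
  rw [ha, map_mul]
  exact mul_self_pos.2 ((map_ne_zero σ).2 ha0)

/-- Off the totally positive locus some real place sees `Δ < 0` (as `Δ ≠ 0`). -/
theorem exists_neg_of_not_discTotallyPositive (K₀ : Type) [Field K₀] [NumberField K₀]
    (E : WeierstrassCurve (𝓞 K₀)) (hΔ : E.Δ ≠ 0) (h : ¬ DiscTotallyPositive K₀ E) :
    ∃ σ : K₀ →+* ℝ, σ (disc K₀ E) < 0 := by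
  simp only [DiscTotallyPositive, not_forall, not_lt] at h
  obtain ⟨σ, hσ⟩ := h
  exact ⟨σ, lt_of_le_of_ne hσ ((map_ne_zero σ).2 (disc_ne_zero K₀ E hΔ))⟩

/-- A totally positive discriminant is negative at no real place. -/
theorem not_exists_neg_of_discTotallyPositive (K₀ : Type) [Field K₀] [NumberField K₀]
    (E : WeierstrassCurve (𝓞 K₀)) (h : DiscTotallyPositive K₀ E) :
    ¬ ∃ σ : K₀ →+* ℝ, σ (disc K₀ E) < 0 := by
  rintro ⟨σ, hσ⟩
  exact absurd (h σ) (not_lt.2 hσ.le)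

/-! ## §2 Bridge lemmas: the `2`-division field of a curve with totally positive discriminant -/

/-- The discriminant of a cubic commutes with ring maps. [folklore] -/
theorem cubic_discr_map {R S : Type} [CommRing R] [CommRing S] (φ : R →+* S) (P : Cubic R) :
    (Cubic.map φ P).discr = φ P.discr := by
  simp only [Cubic.discr, Cubic.map, map_add, map_sub, map_mul, map_pow, map_ofNat]

/-- THE ARCHIMEDEAN HALF OF THE BRIDGE: over a totally real `K₀`, the splitting field of a cubic whose
discriminant is POSITIVE AT EVERY REAL PLACE is totally real (every complex embedding restricts to a real
place `σ` of `K₀`, sends each root to a root of the real cubic `P^σ` of positive discriminant — all of which are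
real by the tree's `conj_eq_of_mem_roots_of_discr_pos` — and the roots generate the field). [folklore] -/
theorem isTotallyReal_splittingField_cubic (K₀ : Type) [Field K₀] [NumberField K₀] [IsTotallyReal K₀]
    (P : Cubic K₀) (ha : P.a ≠ 0) (hpos : ∀ σ : K₀ →+* ℝ, 0 < σ P.discr) :
    IsTotallyReal P.toPoly.SplittingField := by
  have hp0 : P.toPoly ≠ 0 := Cubic.ne_zero_of_a_ne_zero ha
  refine ⟨fun w => ?_⟩
  rw [InfinitePlace.isReal_iff]
  set φ : P.toPoly.SplittingField →+* ℂ := w.embedding with hφdef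
  set σ : K₀ →+* ℂ := φ.comp (algebraMap K₀ P.toPoly.SplittingField) with hσdef
  have hσ : ComplexEmbedding.IsReal σ := IsTotallyReal.complexEmbedding_isReal σ
  letI : Algebra K₀ ℂ := σ.toAlgebra
  have halg : algebraMap K₀ ℂ = σ := RingHom.algebraMap_toAlgebra σ
  -- `φ` and `conj ∘ φ` as `K₀`-algebra maps
  let ψ₁ : P.toPoly.SplittingField →ₐ[K₀] ℂ :=
    { toRingHom := φ
      commutes' := fun k => by
        change φ (algebraMap K₀ P.toPoly.SplittingField k) = algebraMap K₀ ℂ k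
        rw [halg]
        rfl }
  let ψ₂ : P.toPoly.SplittingField →ₐ[K₀] ℂ :=
    { toRingHom := (starRingEnd ℂ).comp φ
      commutes' := fun k => by
        change (starRingEnd ℂ) (φ (algebraMap K₀ P.toPoly.SplittingField k)) = algebraMap K₀ ℂ k
        rw [halg]
        have h := RingHom.congr_fun (ComplexEmbedding.isReal_iff.1 hσ) k
        rw [ComplexEmbedding.conjugate_coe_eq] at h
        exact h }
  -- the real cubic `P^σ`
  set σℝ : K₀ →+* ℝ := hσ.embedding with hσℝ
  have hσℝ' : Complex.ofRealHom.comp σℝ = σ := by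
    ext k
    rw [RingHom.comp_apply]
    exact ComplexEmbedding.IsReal.coe_embedding_apply hσ k
  have haℝ : (Cubic.map σℝ P).a ≠ 0 := by
    show σℝ P.a ≠ 0
    exact (map_ne_zero σℝ).2 ha
  have hdℝ : 0 < (Cubic.map σℝ P).discr := by
    rw [cubic_discr_map]
    exact hpos σℝ
  -- they agree on the roots of `P`, which are real under `φ`
  have hroots : ∀ r ∈ P.toPoly.rootSet P.toPoly.SplittingField, ψ₁ r = ψ₂ r := by
    intro r hr
    rw [Polynomial.mem_rootSet'] at hr
    obtain ⟨-, hr⟩ := hr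
    have h1 : Polynomial.aeval (φ r) P.toPoly = 0 := by
      have h := Polynomial.aeval_algHom_apply ψ₁ r P.toPoly
      rw [hr, map_zero] at h
      exact h
    have hmm : Cubic.map Complex.ofRealHom (Cubic.map σℝ P) = Cubic.map σ P := by
      rw [← hσℝ']
      rfl
    have hmem : φ r ∈ (Cubic.map Complex.ofRealHom (Cubic.map σℝ P)).roots := by
      rw [hmm, Cubic.map_roots, Polynomial.mem_roots (Polynomial.map_ne_zero hp0), Polynomial.IsRoot.def,
        Polynomial.eval_map, ← halg, ← Polynomial.aeval_def]
      exact h1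
    have hreal := Literature.NumberTheory.NumberFields.conj_eq_of_mem_roots_of_discr_pos haℝ hdℝ hmem
    change φ r = (starRingEnd ℂ) (φ r)
    exact hreal.symm
  have hle : Algebra.adjoin K₀ (P.toPoly.rootSet P.toPoly.SplittingField) ≤ AlgHom.equalizer ψ₁ ψ₂ :=
    Algebra.adjoin_le fun r hr => (AlgHom.mem_equalizer ψ₁ ψ₂ r).2 (hroots r hr)
  rw [Polynomial.SplittingField.adjoin_rootSet] at hle
  rw [ComplexEmbedding.isReal_iff]
  ext x
  rw [ComplexEmbedding.conjugate_coe_eq]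
  have hx : ψ₁ x = ψ₂ x := (AlgHom.mem_equalizer ψ₁ ψ₂ x).1 (hle Algebra.mem_top)
  exact hx.symm

/-- THE GALOIS HALF OF THE BRIDGE: the splitting field of a cubic with nonzero discriminant is Galois with
SOLVABLE group (a subgroup of `S₃`, via the faithful action on the three roots and the tree's
`perm_isSolvable_of_card_le_four`). [folklore] -/
theorem isGalois_isSolvable_splittingField_cubic (K₀ : Type) [Field K₀] [NumberField K₀] (P : Cubic K₀)
    (ha : P.a ≠ 0) (hd : P.discr ≠ 0) :
    IsGalois K₀ P.toPoly.SplittingField ∧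
      IsSolvable (P.toPoly.SplittingField ≃ₐ[K₀] P.toPoly.SplittingField) := by
  have hp0 : P.toPoly ≠ 0 := Cubic.ne_zero_of_a_ne_zero ha
  have hsplits : (P.toPoly.map (algebraMap K₀ P.toPoly.SplittingField)).Splits :=
    Polynomial.SplittingField.splits P.toPoly
  haveI : Fact ((P.toPoly.map (algebraMap K₀ P.toPoly.SplittingField)).Splits) := ⟨hsplits⟩
  have hnodup : (Cubic.map (algebraMap K₀ P.toPoly.SplittingField) P).roots.Nodup :=
    (Cubic.discr_ne_zero_iff_roots_nodup ha hsplits).1 hd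
  have hsep : P.toPoly.Separable := by
    rw [← Polynomial.nodup_aroots_iff_of_splits hp0 hsplits, Polynomial.aroots_def, ← Cubic.map_roots]
    exact hnodup
  refine ⟨IsGalois.of_separable_splitting_field hsep, ?_⟩
  have hcard : Fintype.card (P.toPoly.rootSet P.toPoly.SplittingField) ≤ 4 := by
    rw [Polynomial.card_rootSet_eq_natDegree hsep hsplits, Cubic.natDegree_of_a_ne_zero ha]
    norm_num
  haveI : IsSolvable (Equiv.Perm (P.toPoly.rootSet P.toPoly.SplittingField)) :=
    Literature.NumberTheory.NumberFields.perm_isSolvable_of_card_le_four hcard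
  exact solvable_of_solvable_injective (Polynomial.Gal.galActionHom_injective P.toPoly P.toPoly.SplittingField)

/-- Full `2`-torsion is acquired over any extension where the `2`-division cubic splits. -/
theorem fullTwoTorsion_baseChange_of_splits (K₀ M : Type) [Field K₀] [NumberField K₀] [Field M]
    [NumberField M] [Algebra K₀ M] (E : WeierstrassCurve (𝓞 K₀))
    (h : (((E.baseChange K₀).twoTorsionPolynomial).toPoly.map (algebraMap K₀ M)).Splits) :
    FullTwoTorsion M (E.baseChange (𝓞 M)) := by
  unfold FullTwoTorsion
  rw [baseChange_baseChange_eq_map, twoTorsionPolynomial_map, Cubic.map_toPoly]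
  exact h

/-- The residual `j`-range is invariant under base extension (`[ℚ(j):ℚ]` and `ℚ(j)` do not change). -/
theorem inResidualRange_baseChange (F K : Type) [Field F] [NumberField F] [Field K] [NumberField K]
    [Algebra F K] (E₀ : WeierstrassCurve (𝓞 F)) (h : InResidualRange F E₀) :
    InResidualRange K (E₀.baseChange (𝓞 K)) := by
  unfold InResidualRange at h ⊢
  rw [jDeg_baseChange]
  rcases h with h5 | ⟨h4, hsq⟩
  · exact Or.inl h5
  · refine Or.inr ⟨h4, ?_⟩
    rw [jInv_baseChange]
    have hj' : jInv F E₀ = (algebraMap (𝓞 F) F E₀.c₄) ^ 3 / algebraMap (𝓞 F) F E₀.Δ := rfl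
    rw [← hj']
    have key : ℚ⟮algebraMap F K (jInv F E₀)⟯ = (ℚ⟮jInv F E₀⟯).map (IsScalarTower.toAlgHom ℚ F K) := by
      rw [IntermediateField.adjoin_map]
      simp
    let e : ℚ⟮jInv F E₀⟯ ≃ₐ[ℚ] ℚ⟮algebraMap F K (jInv F E₀)⟯ :=
      (IntermediateField.equivMap ℚ⟮jInv F E₀⟯ (IsScalarTower.toAlgHom ℚ F K)).trans
        (IntermediateField.equivOfEq key.symm)
    have h5 := hsq.map e
    rwa [map_ofNat] at h5

/-- FULL `2`-TORSION FORCES A SQUARE DISCRIMINANT: `16 Δ = disc = (a²(x−y)(x−z)(y−z))²` with the three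
roots in `K₀`.  (So F2T ⊂ R_sq ∩ R_tors: the new residual core lies inside BOTH g28 sub-loci it replaces.) -/
theorem isSquare_disc_of_fullTwoTorsion (K₀ : Type) [Field K₀] [NumberField K₀] (E : WeierstrassCurve (𝓞 K₀))
    (hft : FullTwoTorsion K₀ E) : IsSquare (disc K₀ E) := by
  have ha := twoTorsionPolynomial_a_ne_zero K₀ E
  have hdiscr := twoTorsionPolynomial_discr_eq K₀ E
  set P : Cubic K₀ := (E.baseChange K₀).twoTorsionPolynomial with hP
  have hsplit : (P.toPoly.map (RingHom.id K₀)).Splits := by rw [Polynomial.map_id]; exact hft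
  obtain ⟨x, y, z, h3⟩ := (Cubic.splits_iff_roots_eq_three ha).1 hsplit
  have hd := Cubic.discr_eq_prod_three_roots ha h3
  simp only [RingHom.id_apply] at hd
  set w : K₀ := P.a * P.a * (x - y) * (x - z) * (y - z) with hw
  refine ⟨w / 4, ?_⟩
  have h16 : 16 * disc K₀ E = w ^ 2 := by rw [← hdiscr, hd]
  field_simp
  linear_combination h16

/-- A split cubic has a root: full `2`-torsion gives a rational `2`-torsion point. -/
theorem exists_root_of_fullTwoTorsion (K₀ : Type) [Field K₀] [NumberField K₀] (E : WeierstrassCurve (𝓞 K₀))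
    (hft : FullTwoTorsion K₀ E) : ∃ x : K₀, ((E.baseChange K₀).twoTorsionPolynomial).toPoly.IsRoot x := by
  have ha := twoTorsionPolynomial_a_ne_zero K₀ E
  obtain ⟨x, hx⟩ := Polynomial.Splits.exists_eval_eq_zero hft
    (by rw [Cubic.degree_of_a_ne_zero ha]; decide)
  exact ⟨x, Polynomial.IsRoot.def.2 hx⟩

/-! ## §3 The pieces of RES (all but the junctions are sub-cases of g28's sub-loci) -/

/-- F2T (the NEW RESIDUAL CORE; WEAKER — a sub-case of BOTH R_tors and R_sq; IDEA-NEEDED): RES on the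
FULL-`2`-TORSION locus — every integral `E` (`Δ ≠ 0`) over an unanchored totally real field of degree `≥ 6`,
of residual moduli degree, with `E[2] ⊂ E(K₀)` (`ρ̄_{E,2}` trivial), is modular. -/
def FullTwoTorsionResidual : Prop :=
  ∀ (K₀ : Type) [Field K₀] [NumberField K₀], UnanchoredBox K₀ →
    ∀ E : WeierstrassCurve (𝓞 K₀), E.Δ ≠ 0 → InResidualRange K₀ E → FullTwoTorsion K₀ E →
      IsModularEllipticCurve K₀ E

/-- R₂⁻ (residual; WEAKER — a sub-case of R_tors; IDEA-NEEDED): a `K₀`-rational `2`-torsion point AND `Δ`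
negative at some real place (so `K₀(E[2]) = K₀(√Δ)` has a complex place: no totally real solvable ascent
reaches full `2`-torsion). -/
def MixedSignTwoTorsionResidual : Prop :=
  ∀ (K₀ : Type) [Field K₀] [NumberField K₀], UnanchoredBox K₀ →
    ∀ E : WeierstrassCurve (𝓞 K₀), E.Δ ≠ 0 → InResidualRange K₀ E →
      (∃ x : K₀, ((E.baseChange K₀).twoTorsionPolynomial).toPoly.IsRoot x) →
      (∃ σ : K₀ →+* ℝ, σ (disc K₀ E) < 0) → IsModularEllipticCurve K₀ E

/-- R_ss⁻ (residual; WEAKER — a sub-case of R_ss; IDEA-NEEDED): NO rational `2`-torsion, `v(j) > 0` at some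
`v ∣ 2`, AND `Δ` negative at some real place (index `6`, the Allen door fails at (a), and the sign forbids the
ascent). -/
def NegativePlaceSupersingularResidual : Prop :=
  ∀ (K₀ : Type) [Field K₀] [NumberField K₀], UnanchoredBox K₀ →
    ∀ E : WeierstrassCurve (𝓞 K₀), E.Δ ≠ 0 → InResidualRange K₀ E → NoRationalTwoTorsion K₀ E →
      (∃ v : HeightOneSpectrum (𝓞 K₀), (2 : 𝓞 K₀) ∈ v.asIdeal ∧ v.valuation K₀ (jInv K₀ E) < 1) →
      (∃ σ : K₀ →+* ℝ, σ (disc K₀ E) < 0) → IsModularEllipticCurve K₀ E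

/-- R_cm⁶ (residual; WEAKER — a sub-case of R_cm; IDEA-NEEDED): NO rational `2`-torsion (irreducible
`2`-division cubic), `Δ` totally negative and a square in every `K₀ᵥ`, `v ∣ 2` (Allen's condition (5) fails;
the CM components). -/
def IrreducibleCMComponentResidual : Prop :=
  ∀ (K₀ : Type) [Field K₀] [NumberField K₀], UnanchoredBox K₀ →
    ∀ E : WeierstrassCurve (𝓞 K₀), E.Δ ≠ 0 → InResidualRange K₀ E → NoRationalTwoTorsion K₀ E →
      (∀ σ : K₀ →+* ℝ, σ (disc K₀ E) < 0) →
      (∀ v : HeightOneSpectrum (𝓞 K₀), (2 : 𝓞 K₀) ∈ v.asIdeal →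
        IsSquare (algebraMap K₀ (v.adicCompletion K₀) (disc K₀ E))) →
      IsModularEllipticCurve K₀ E

/-! ### The price of the overfield move: full `2`-torsion over ANCHORED fields (S-implied glue) -/

/-- Clause (A) of the host's anchor: abelian with `3, 5, 7 ∤ disc`, or inside a cyclotomic `ℤ_p`-tower
(verbatim the third clause of `DepthIsolationSplit.UnanchoredBox`). -/
def ClauseA (M : Type) [Field M] [NumberField M] : Prop :=
  (IsGalois ℚ M ∧ (∀ σ τ : M ≃ₐ[ℚ] M, σ * τ = τ * σ) ∧ ¬ ((3 : ℤ) ∣ NumberField.discr M) ∧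
      ¬ ((5 : ℤ) ∣ NumberField.discr M) ∧ ¬ ((7 : ℤ) ∣ NumberField.discr M)) ∨
    (∃ p : ℕ, p.Prime ∧ Literature.NumberTheory.Automorphic.Thorne2019.IsInCyclotomicZpExtension p M)

/-- Clause (B5) of the host's anchor: a `15`-stable odd solvable cover of a field of degree `≤ 5`, `√5 ∉ M`
(verbatim the fourth clause of `UnanchoredBox`). -/
def ClauseB5 (M : Type) [Field M] [NumberField M] : Prop :=
  ¬ IsSquare (5 : M) ∧ ∃ F : IntermediateField ℚ M, Module.finrank ℚ F ≤ 5 ∧ IsGalois F M ∧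
    IsSolvable (M ≃ₐ[F] M) ∧ Odd (Module.finrank F M) ∧ ∀ x y : M,
      (Literature.NumberTheory.Automorphic.Thorne2019.E₁.baseChange M).toAffine.Equation x y →
        x ∈ Set.range (algebraMap F M) ∧ y ∈ Set.range (algebraMap F M)

/-- Clause (B7) of the host's anchor: a `21`-stable odd solvable cover of a field of degree `≤ 5`, `7 ∤ disc M`
(verbatim the fifth clause of `UnanchoredBox`). -/
def ClauseB7 (M : Type) [Field M] [NumberField M] : Prop :=
  ¬ ((7 : ℤ) ∣ NumberField.discr M) ∧ ∃ F : IntermediateField ℚ M, Module.finrank ℚ F ≤ 5 ∧ IsGalois F M ∧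
    IsSolvable (M ≃ₐ[F] M) ∧ Odd (Module.finrank F M) ∧ ∀ x y : M,
      ((⟨1, 0, 0, -4, -1⟩ : WeierstrassCurve ℚ).baseChange M).toAffine.Equation x y →
        x ∈ Set.range (algebraMap F M) ∧ y ∈ Set.range (algebraMap F M)

/-- The box, clause by clause (definitional). -/
theorem unanchoredBox_iff (M : Type) [Field M] [NumberField M] :
    UnanchoredBox M ↔ IsTotallyReal M ∧ ¬ (Module.finrank ℚ M ≤ 5) ∧ ¬ ClauseA M ∧ ¬ ClauseB5 M ∧ ¬ ClauseB7 M :=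
  Iff.rfl

/-- F2T_anch (GLUE; S-IMPLIED — it is HIGH_E on (anchored locus) ∩ (full `2`-torsion, residual `j`-range);
NOT implied by RES: the declared price of the overfield move, since the `2`-division field of a box field may
be a `15`- or `21`-stable anchored cover): every integral `E` with full rational `2`-torsion, of residual moduli
degree, over an ANCHORED totally real field of degree `≥ 6`, is modular.  Its (A)-cell is discharged below from
the tree facts `Yoshikawa2019_theorem1_2` / `Thorne2019_thm1` BY NAME; its (B5)/(B7)-cells are the E-level
cores of the host items stmt-Langlands-26996 / 26997 on the full-`2`-torsion locus (print bridge to the base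
range: Thorne 2016 Thm 7.6 + Yoshikawa 2022 Cor. 3.6 (proof) / Yoshikawa 2016 Thm 1.5). -/
def AnchoredFullTwoTorsion : Prop :=
  ∀ (M : Type) [Field M] [NumberField M], IsTotallyReal M → ¬ (Module.finrank ℚ M ≤ 5) → ¬ UnanchoredBox M →
    ∀ E : WeierstrassCurve (𝓞 M), E.Δ ≠ 0 → InResidualRange M E → FullTwoTorsion M E →
      IsModularEllipticCurve M E

/-- F2T_B (the (B5) ∨ (B7) cells of F2T_anch; PRINT BRIDGE to the base range, by proof — as host items
26996/26997). -/
def AnchoredBFullTwoTorsion : Prop :=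
  ∀ (M : Type) [Field M] [NumberField M], IsTotallyReal M → ¬ (Module.finrank ℚ M ≤ 5) →
    (ClauseB5 M ∨ ClauseB7 M) →
    ∀ E : WeierstrassCurve (𝓞 M), E.Δ ≠ 0 → InResidualRange M E → FullTwoTorsion M E →
      IsModularEllipticCurve M E

/-- The (A)-cell of F2T_anch is PRINT AND VENDORED: Yoshikawa 2019 Thm 1.2 (abelian, `3·5·7 ∤ disc`) and
Thorne 2019 Thm 1 (cyclotomic `ℤ_p`-towers), tree facts BY NAME; so F2T_anch ⟸ facts ∧ F2T_B. -/
theorem anchoredFullTwoTorsion_of_cells (hY : Yoshikawa2019_theorem1_2) (hTh : Thorne2019_thm1)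
    (hB : AnchoredBFullTwoTorsion) : AnchoredFullTwoTorsion := by
  intro M _ _ hTR hdeg hnot E hΔ hr hft
  haveI := hTR
  by_cases hA : ClauseA M
  · rcases hA with ⟨hG, hab, h3, h5, h7⟩ | ⟨p, hp, hcyc⟩
    · exact hY.isModularEllipticCurve M hG hab h3 h5 h7 E hΔ
    · exact hTh p hp M hcyc E hΔ
  · by_cases hB5 : ClauseB5 M
    · exact hB M hTR hdeg (Or.inl hB5) E hΔ hr hft
    · by_cases hB7 : ClauseB7 M
      · exact hB M hTR hdeg (Or.inr hB7) E hΔ hr hft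
      · exact absurd ((unanchoredBox_iff M).2 ⟨hTR, hdeg, hA, hB5, hB7⟩) hnot

end Summit.Langlands.Langlands.Theorems.TwoDivisionFieldSplit
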